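import Summits.BirchSwinnertonDyer.Rank1Residual.Iwasawa.DualPairFiniteResidue
import Summits.BirchSwinnertonDyer.Rank1Residual.Iwasawa.DatumDualRestriction
import Summits.BirchSwinnertonDyer.Rank1Residual.Iwasawa.MuZeroQuotientCard
import Literature.NumberTheory.EllipticCurves.ZpCorankQuasiIso
import HarnessLib

/-!
# Conclusions 1–3 of Greenberg–Vatsal 2000 Cor. (2.3) at the datum `(E[p^∞], C)` IN THE KERNEL:
# `X^{Σ₀} = S^{Σ₀}_A(K_∞)^` is finitely generated and `Λ`-torsion with `μ(X^{Σ₀}) = μ(X)`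
# (and `λ(X) ≤ λ(X^{Σ₀})`) — conclusions 1–3 ONLY; 4–5 (the `λ`-shift `+ Σ δ_v`, the
# `p`-divisibility of `S^{Σ₀}/S`) are NOT claimed (they need GV Prop. (2.1), global duality)

HONEST FRAMING (cell `b2b-bsdres`, run/shared/lean/b2b/bsd-rank1-residual/, verbatim in every
file): the goal of the cell is to DELETE the COMBINATION-SHAPED residual classes of the
Birch–Swinnerton-Dyer formula for ALL analytic-rank `≤ 1` elliptic curves over `ℚ` — "full BSD
formula for every rank `≤ 1` curve in class `C`" assembled STRICTLY from published theorems — so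
that the rank-`≤ 1` remainder becomes exactly the CONSTRUCTION-SHAPED classes, which are TYPED
(missing-input `Prop`s), NOT attempted. This is not "finishing BSD". Team n1011 (N10/N11; row
T-GV23-PA = the located gap P-α of the A240 derivation): research routes on CONSTRUCTION-SHAPED
classes; prove what is provable now; no claim beyond stated classes; census output = EVIDENCE,
never a Literature fact; RESIDUAL-MAP marks UNCHANGED; nothing is booked by this file. TOOL
THEOREMS ONLY: no definition, no named fact; the cited record
`GreenbergVatsal2000.datumSelmer_nonPrimitive_invariants` (T-GV23L, `h23`) is NOT used and NOT
touched — this file proves its conclusions 1–3 outright, with fewer hypotheses; conclusions 4–5 of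
`h23` remain named-fact territory (GV Prop. (2.1) = Poitou–Tate + Cassels, absent from the tree).

## What

For a number field `K`, an elliptic curve `E/K`, a prime `p`, a `ℤ_p`-extension `κ` (`H = ker κ`)
with topological generator `γ`, ANY Greenberg data `L` for `A = E[p^∞]`, a finite set `S₀` whose
members `v ∤ p` are finitely decomposed in `K_∞` (`hD`; automatic for the CYCLOTOMIC `κ`), and
Pontryagin-dual data `X` of `S = S_A(K_∞) = datumSelmerInfty κ A L ∅` and `X₀` of
`S^{S₀} = S^{Σ₀}_A(K_∞) = datumSelmerInfty κ A L ↑S₀`: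

* `finite_torsionBy_quotient_of_cover`, `finite_modN_characterModule_of_finite_torsionBy`,
  `finite_modN_ker_of_cover` (§1): from the finite-coset cover of the `p`-torsion of `S^{S₀}/S`
  (sibling `exists_finset_forall_sub_mem_of_nsmul_mem`), `(ker r)/p` is finite for the dual
  `r : X₀ ↠ X` (`ker r ≅ Hom(S^{S₀}/S, ℚ/ℤ)`, gen-3 `exists_restrictModN_bijective`).
* **`datumSelmer_nonPrimitive_moduleFinite_isTorsion_mu_eq`** (§2, END): `X₀` is finitely
  generated (converse Nakayama on `X` ⇒ `S[𝔪]` finite ⇒ `S^{S₀}[𝔪]` finite ⇒ Nakayama), `Λ`-torsion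
  (`(ker r)/p` finite ⇒ `ker r` torsion, `isTorsion_of_finite_modN`; extension), `μ(X₀) = μ(X)` and
  `λ(X) ≤ λ(X₀)` (`mu_eq_and_lambda_le_of_surjective_of_finite_modN_ker`); plus the cyclotomic
  form `…_of_isCyclotomic` (`K : Type`) and the `h23`-binder-shaped form `…_rat` over `ℚ`.

GV 2000 Cor. (2.3) (arXiv:math/9906215 pp. 20–21): "`S^{Σ₀}_A(ℚ_∞)` is `Λ`-cotorsion … The
`μ`-invariants of `S^{Σ₀}_A(ℚ_∞)^` and `S_A(ℚ_∞)^` are equal." — here for `A = E[p^∞]` and ANY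
line `C`, any number field, any `p`, WITHOUT `H⁰(ℚ_∞, A*)` finite, WITHOUT `p` odd, from nothing
cited. NOT claimed: `S^{Σ₀}/S ≅ ∏ 𝓗_ℓ` (Prop. (2.1)), `λ(X₀) = λ(X) + Σ s_ℓ d_ℓ` (Prop. (2.4)),
`S^{Σ₀}/S` `p`-divisible.

References: R. Greenberg, V. Vatsal, Invent. Math. 142 (2000) §2 pp. 17, 20–22; R. Greenberg,
LNM 1716 §1 p. 60; L. Washington, *Introduction to Cyclotomic Fields*, §13.2.
-/

noncomputable section

open scoped Classical AddSubgroup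
open NumberField IsDedekindDomain Field
open Literature.NumberTheory.GaloisRepresentations Literature.NumberTheory.EllipticCurves
  Literature.NumberTheory.EllipticCurves.GreenbergSelmer
  Literature.NumberTheory.EllipticCurves.GreenbergVatsal2000
  Literature.NumberTheory.EllipticCurves.IwasawaDual

universe u

namespace Summit.BirchSwinnertonDyer.Rank1Residual.Iwasawa

/-! ## §1. `(ker r)/p` is finite from the finite-coset cover of the `p`-torsion of `S^{S₂}/S^{S₁}` -/

section KernelModP

variable {K : Type u} [Field K] [NumberField K] (W : WeierstrassCurve K) {p : ℕ} [Fact p.Prime]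
  (κ : ZpExtension K p) {γ : absoluteGaloisGroup K} (L : Data K (W.geomPrimaryTorsion p) p)
  {S₁ S₂ : Set (HeightOneSpectrum (𝓞 K))} (h12 : S₁ ⊆ S₂)

/-- **The `p`-torsion of `B = S^{S₂}/S^{S₁}` is finite** (quotient of the subgroup `S^{S₂}` by the
trace of `S^{S₁}`), granted a finite set `F ⊆ S^{S₂}` meeting every class `s + S^{S₁}` with
`p s ∈ S^{S₁}` (`hF`, the sibling `exists_finset_forall_sub_mem_of_nsmul_mem`): `B[p]` lies in the
image of `F`. GV 2000 p. 20. [cite: GreenbergVatsal2000, §2 pp. 20–21] -/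
theorem finite_torsionBy_quotient_of_cover
    (hF : ∃ F : Finset ↥(datumSelmerInfty κ (W.geomPrimaryTorsion p) L S₂),
      ∀ s : ↥(datumSelmerInfty κ (W.geomPrimaryTorsion p) L S₂),
        p • (s : W.subgroupH1 p κ.kerSubgroup) ∈ datumSelmerInfty κ (W.geomPrimaryTorsion p) L S₁ →
          ∃ f ∈ F, (s : W.subgroupH1 p κ.kerSubgroup) - (f : W.subgroupH1 p κ.kerSubgroup) ∈
            datumSelmerInfty κ (W.geomPrimaryTorsion p) L S₁) :
    Finite ((↥(datumSelmerInfty κ (W.geomPrimaryTorsion p) L S₂) ⧸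
      (datumSelmerInfty κ (W.geomPrimaryTorsion p) L S₁).addSubgroupOf
        (datumSelmerInfty κ (W.geomPrimaryTorsion p) L S₂))[(p : ℤ)]) := by
  set SS := datumSelmerInfty κ (W.geomPrimaryTorsion p) L S₂ with hSS
  set S := datumSelmerInfty κ (W.geomPrimaryTorsion p) L S₁ with hS
  set N : AddSubgroup SS := S.addSubgroupOf SS with hN
  have hNmem : ∀ s : SS, s ∈ N ↔ (s : W.subgroupH1 p κ.kerSubgroup) ∈ S := fun s ↦
    AddSubgroup.mem_addSubgroupOf
  obtain ⟨F, hF⟩ := hF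
  have hBp : Set.Finite (((SS ⧸ N)[(p : ℤ)] : AddSubgroup (SS ⧸ N)) : Set (SS ⧸ N)) := by
    refine ((F.finite_toSet).image (QuotientAddGroup.mk' N)).subset fun b hb ↦ ?_
    obtain ⟨s, rfl⟩ := QuotientAddGroup.mk'_surjective N b
    have h1 : QuotientAddGroup.mk' N (p • s) = 0 := by
      rw [map_nsmul]; exact AddSubgroup.torsionBy.nsmul_iff.mp hb
    have hb' : p • s ∈ N := (QuotientAddGroup.eq_zero_iff _).mp h1
    have hps : p • (s : W.subgroupH1 p κ.kerSubgroup) ∈ S := by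
      have h2 := (hNmem _).mp hb'
      rwa [AddSubgroupClass.coe_nsmul] at h2
    obtain ⟨f, hfF, hf⟩ := hF s hps
    refine ⟨f, Finset.mem_coe.2 hfF, ?_⟩
    rw [QuotientAddGroup.mk'_apply, QuotientAddGroup.mk'_apply, eq_comm,
      QuotientAddGroup.eq_iff_sub_mem, hNmem, AddSubgroupClass.coe_sub]
    exact hf
  exact hBp.to_subtype

omit [Fact p.Prime] in
/-- `Hom(B, ℚ/ℤ)/p` is finite when `B[p]` is (gen-3 `exists_restrictModN_bijective`:
`Hom(B, ℚ/ℤ)/p ≅ Hom(B[p], ℚ/ℤ)`, and a finite group has a finite character group). [folklore] -/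
theorem finite_modN_characterModule_of_finite_torsionBy (B : Type u) [AddCommGroup B]
    [Finite (B[(p : ℤ)])] : Finite (ModN (CharacterModule B) p) := by
  obtain ⟨ρ, -, hρ⟩ := exists_restrictModN_bijective p B
  haveI : Finite (CharacterModule (B[(p : ℤ)])) := PontryaginCard.finite_characterModule_of_finite _
  exact Finite.of_injective ρ hρ.1

/-- **`(ker r)/p` is finite** for the dual `r : X₀ ↠ X` of `S^{S₁} ↪ S^{S₂}` (`hrker`: its kernel
is `{x | toDual x kills S^{S₁}}`), granted the finite-coset cover `hF` of the `p`-torsion of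
`B = S^{S₂}/S^{S₁}`: `Hom(B, ℚ/ℤ) ↠ ker r` (a character of `S^{S₂}` killing `S^{S₁}` is a character of
`B`), `Hom(B, ℚ/ℤ)/p ≅ Hom(B[p], ℚ/ℤ)` is finite. GV 2000 p. 20 ("`𝓗_ℓ(ℚ_∞)` is `Λ`-cotorsion for
`ℓ ≠ p`"), in the only currency needed here. [cite: GreenbergVatsal2000, §2 pp. 20–21] -/
theorem finite_modN_ker_of_cover (X₀ : DatumDualData κ γ (W.geomPrimaryTorsion p) L S₂)
    {Y : Type*} [AddCommGroup Y] [Module (IwasawaAlgebra p) Y] (r : X₀.X →ₗ[IwasawaAlgebra p] Y)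
    (hrker : ∀ x : X₀.X, r x = 0 ↔ ∀ s : datumSelmerInfty κ (W.geomPrimaryTorsion p) L S₁,
      X₀.toDual x (AddSubgroup.inclusion
        (datumSelmerInfty_mono κ h12 (W.geomPrimaryTorsion p) L) s) = 0)
    (hF : ∃ F : Finset ↥(datumSelmerInfty κ (W.geomPrimaryTorsion p) L S₂),
      ∀ s : ↥(datumSelmerInfty κ (W.geomPrimaryTorsion p) L S₂),
        p • (s : W.subgroupH1 p κ.kerSubgroup) ∈ datumSelmerInfty κ (W.geomPrimaryTorsion p) L S₁ →
          ∃ f ∈ F, (s : W.subgroupH1 p κ.kerSubgroup) - (f : W.subgroupH1 p κ.kerSubgroup) ∈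
            datumSelmerInfty κ (W.geomPrimaryTorsion p) L S₁) :
    Finite (ModN (LinearMap.ker r) p) := by
  set SS := datumSelmerInfty κ (W.geomPrimaryTorsion p) L S₂ with hSS
  set S := datumSelmerInfty κ (W.geomPrimaryTorsion p) L S₁ with hS
  have hle : S ≤ SS := datumSelmerInfty_mono κ h12 (W.geomPrimaryTorsion p) L
  set N : AddSubgroup SS := S.addSubgroupOf SS with hN
  have hNmem : ∀ s : SS, s ∈ N ↔ (s : W.subgroupH1 p κ.kerSubgroup) ∈ S := fun s ↦
    AddSubgroup.mem_addSubgroupOf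
  haveI : Finite ((SS ⧸ N)[(p : ℤ)]) := finite_torsionBy_quotient_of_cover W κ L hF
  haveI : Finite (ModN (CharacterModule (SS ⧸ N)) p) :=
    finite_modN_characterModule_of_finite_torsionBy (p := p) (SS ⧸ N)
  -- `Hom(B, ℚ/ℤ) ↠ ker r`
  let e₀ := AddEquiv.ofBijective X₀.toDual X₀.bijective
  have key : ∀ χ, X₀.toDual (e₀.symm χ) = χ := fun χ ↦ e₀.apply_symm_apply χ
  have hmk : ∀ s : S, QuotientAddGroup.mk' N (AddSubgroup.inclusion hle s) = 0 := fun s ↦ by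
    rw [QuotientAddGroup.mk'_apply, QuotientAddGroup.eq_zero_iff, hNmem, AddSubgroup.coe_inclusion]
    exact s.2
  have hmem : ∀ χ : CharacterModule (SS ⧸ N),
      e₀.symm (AddMonoidHom.comp χ (QuotientAddGroup.mk' N)) ∈ LinearMap.ker r := fun χ ↦ by
    rw [LinearMap.mem_ker, hrker]
    intro s
    rw [key, AddMonoidHom.comp_apply]
    exact (congrArg χ (hmk s)).trans (map_zero χ)
  let g : CharacterModule (SS ⧸ N) → LinearMap.ker r := fun χ ↦ ⟨_, hmem χ⟩
  have hg0 : g 0 = 0 := Subtype.ext (by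
    change e₀.symm _ = 0
    rw [show AddMonoidHom.comp (0 : CharacterModule (SS ⧸ N)) (QuotientAddGroup.mk' N) = 0 from
      AddMonoidHom.ext fun _ ↦ rfl, map_zero])
  have hgadd : ∀ χ χ', g (χ + χ') = g χ + g χ' := fun χ χ' ↦ Subtype.ext (by
    change e₀.symm _ = e₀.symm _ + e₀.symm _
    rw [← map_add]
    exact congrArg e₀.symm (AddMonoidHom.ext fun _ ↦ rfl))
  let g' : CharacterModule (SS ⧸ N) →+ LinearMap.ker r :=
    { toFun := g, map_zero' := hg0, map_add' := hgadd }
  have hg : Function.Surjective g' := by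
    rintro ⟨y, hy⟩
    have hkill : N ≤ (X₀.toDual y).ker := fun n hn ↦ by
      rw [AddMonoidHom.mem_ker]
      have h := (hrker y).1 (LinearMap.mem_ker.1 hy) ⟨(n : W.subgroupH1 p κ.kerSubgroup), (hNmem n).1 hn⟩
      have e : AddSubgroup.inclusion hle ⟨(n : W.subgroupH1 p κ.kerSubgroup), (hNmem n).1 hn⟩ = n :=
        Subtype.ext (AddSubgroup.coe_inclusion _ _)
      rwa [e] at h
    refine ⟨QuotientAddGroup.lift N (X₀.toDual y) hkill, Subtype.ext ?_⟩
    change e₀.symm (AddMonoidHom.comp (QuotientAddGroup.lift N (X₀.toDual y) hkill)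
      (QuotientAddGroup.mk' N)) = y
    apply X₀.bijective.1
    rw [key]
    exact AddMonoidHom.ext fun s ↦ QuotientAddGroup.lift_mk' N hkill s
  exact Finite.of_surjective _ (modNMap_surjective hg p)

end KernelModP

/-! ## §2. END: `X^{Σ₀}` finitely generated, `Λ`-torsion, `μ(X^{Σ₀}) = μ(X)`, `λ(X) ≤ λ(X^{Σ₀})` -/

section End

variable {K : Type u} [Field K] [NumberField K] (W : WeierstrassCurve K) [W.IsElliptic]
  {p : ℕ} [Fact p.Prime] (κ : ZpExtension K p) {γ : absoluteGaloisGroup K}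

/-- **Greenberg–Vatsal 2000 Cor. (2.3), conclusions 1–3, at the datum `(E[p^∞], C)` — IN THE
KERNEL, general form.** `K` any number field, `E/K` any elliptic curve, `p` any prime, `κ` any
`ℤ_p`-extension with topological generator `γ`, `L` ANY Greenberg data above `p` (no condition on
the lines), `S₀` a finite set of places whose members `v ∤ p` are FINITELY DECOMPOSED in `K_∞`
(`hD : ∃ δ ∈ D_v, κ δ ≠ 1` — the displayed hypothesis; it fails for inert `v` in the anticyclotomic
tower and holds for the cyclotomic tower, `…_of_isCyclotomic`), `X` a Pontryagin-dual datum of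
`S = S_A(K_∞)` which is finitely generated and `Λ`-torsion, `X₀` any Pontryagin-dual datum of
`S^{S₀} = S^{Σ₀}_A(K_∞)`. THEN: `X₀` is finitely generated over `Λ`, `Λ`-torsion,
`μ(X₀) = μ(X)`, and `λ(X) ≤ λ(X₀)`. GV p. 21: "`S^{Σ₀}_A(ℚ_∞)` is `Λ`-cotorsion … The
`μ`-invariants of `S^{Σ₀}_A(ℚ_∞)^` and `S_A(ℚ_∞)^` are equal." Chain: converse Nakayama on `X`
(`finite_piece_one_of_isDualPair_of_moduleFinite`) ⇒ `S[𝔪]` finite ⇒ `S^{S₀}[𝔪]` finite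
(`finite_piece_one_nonPrimitive_of_finite_piece_one`) ⇒ `X₀` f.g. (`IsDualPair.module_finite`);
`r : X₀ ↠ X` (`exists_restrictDual`), `(ker r)/p` finite (`finite_modN_ker_of_cover` with
`exists_finset_forall_sub_mem_of_nsmul_mem`) ⇒ `ker r` torsion (`isTorsion_of_finite_modN`) ⇒ `X₀`
torsion; `μ`, `λ` by `mu_eq_and_lambda_le_of_surjective_of_finite_modN_ker`. CONCLUSIONS 1–3 ONLY:
`λ(X₀) = λ(X) + Σ s_ℓ d_ℓ` and the `p`-divisibility of `S^{Σ₀}/S` (GV Prop. (2.1), (2.4)) are NOT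
claimed. [cite: GreenbergVatsal2000, §2 Cor. (2.3) (arXiv:math/9906215 pp. 20–21)] -/
theorem datumSelmer_nonPrimitive_moduleFinite_isTorsion_mu_eq (hγ : κ.IsTopGenerator γ)
    (L : Data K (W.geomPrimaryTorsion p) p) (S₀ : Finset (HeightOneSpectrum (𝓞 K)))
    (hD : ∀ v ∈ S₀, ((p : ℕ) : 𝓞 K) ∉ v.asIdeal → ∃ δ ∈ decomp (K := K) v, κ δ ≠ 1)
    (X : DatumDualData κ γ (W.geomPrimaryTorsion p) L (∅ : Set (HeightOneSpectrum (𝓞 K))))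
    [Module.Finite (IwasawaAlgebra p) X.X] (hX : Module.IsTorsion (IwasawaAlgebra p) X.X)
    (X₀ : DatumDualData κ γ (W.geomPrimaryTorsion p) L (↑S₀ : Set (HeightOneSpectrum (𝓞 K)))) :
    Module.Finite (IwasawaAlgebra p) X₀.X ∧ Module.IsTorsion (IwasawaAlgebra p) X₀.X ∧
      muInvariant p X₀.X = muInvariant p X.X ∧ lambdaInvariant p X.X ≤ lambdaInvariant p X₀.X := by
  have h0 : (∅ : Set (HeightOneSpectrum (𝓞 K))) ⊆ ↑S₀ := Set.empty_subset _
  -- (1) finite generation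
  haveI : Finite (piece p (conjDatum W κ L (∅ : Set (HeightOneSpectrum (𝓞 K))) γ - 1) 1) :=
    finite_piece_one_of_isDualPair_of_moduleFinite (isDualPair_datumDualData W κ L _ hγ X)
  have hfin₀ := finite_piece_one_nonPrimitive_of_finite_piece_one W κ hγ L S₀ hD (Set.toFinite _)
  haveI : Module.Finite (IwasawaAlgebra p) X₀.X :=
    (isDualPair_datumDualData W κ L _ hγ X₀).module_finite hfin₀
  -- (2) torsion, via the dual restriction `r : X₀ ↠ X`
  obtain ⟨r, -, hsurj, hker⟩ := exists_restrictDual W κ L h0 hγ X X₀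
  haveI : Finite (ModN (LinearMap.ker r) p) :=
    finite_modN_ker_of_cover W κ L h0 X₀ r hker
      (exists_finset_forall_sub_mem_of_nsmul_mem W κ hγ L S₀ hD)
  haveI : Module.Finite (IwasawaAlgebra p) (LinearMap.ker r) := moduleFinite_ker p r
  have hKt : Module.IsTorsion (IwasawaAlgebra p) (LinearMap.ker r) :=
    isTorsion_of_finite_modN p (LinearMap.ker r)
  have hX₀ : Module.IsTorsion (IwasawaAlgebra p) X₀.X :=
    X2.DualRestrictionInvariants.isTorsion_of_surjective_of_ker p r hKt hX
  -- (3) `μ` and `λ`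
  obtain ⟨hmu, hlam⟩ := mu_eq_and_lambda_le_of_surjective_of_finite_modN_ker p r hX₀ hsurj
  exact ⟨inferInstance, hX₀, hmu, hlam⟩

end End

/-! ### The cyclotomic tower (`K : Type`) and the `h23`-binder-shaped form over `ℚ` -/

section Cyclotomic

variable {K : Type} [Field K] [NumberField K] (W : WeierstrassCurve K) [W.IsElliptic]
  {p : ℕ} [Fact p.Prime] (κ : ZpExtension K p) {γ : absoluteGaloisGroup K}

/-- **The CYCLOTOMIC form** (any number field `K : Type`, any elliptic `E/K`, any `p`, any data
`L`, any finite `S₀` of places `∌ p`): for the cyclotomic `ℤ_p`-extension every `v ∤ p` is finitely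
decomposed (`exists_mem_decomp_apply_ne_one_of_isCyclotomic`), so the general theorem applies:
`X₀` f.g., `Λ`-torsion, `μ(X₀) = μ(X)`, `λ(X) ≤ λ(X₀)`. Conclusions 1–3 of GV Cor. (2.3) only; 4–5
not claimed. [cite: GreenbergVatsal2000, §2 Cor. (2.3) (arXiv:math/9906215 pp. 20–21)] -/
theorem datumSelmer_nonPrimitive_moduleFinite_isTorsion_mu_eq_of_isCyclotomic
    (hκ : κ.IsCyclotomic) (hγ : κ.IsTopGenerator γ)
    (L : Data K (W.geomPrimaryTorsion p) p) (S₀ : Finset (HeightOneSpectrum (𝓞 K)))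
    (hS₀ : ∀ v ∈ S₀, ((p : ℕ) : 𝓞 K) ∉ v.asIdeal)
    (X : DatumDualData κ γ (W.geomPrimaryTorsion p) L (∅ : Set (HeightOneSpectrum (𝓞 K))))
    [Module.Finite (IwasawaAlgebra p) X.X] (hX : Module.IsTorsion (IwasawaAlgebra p) X.X)
    (X₀ : DatumDualData κ γ (W.geomPrimaryTorsion p) L (↑S₀ : Set (HeightOneSpectrum (𝓞 K)))) :
    Module.Finite (IwasawaAlgebra p) X₀.X ∧ Module.IsTorsion (IwasawaAlgebra p) X₀.X ∧
      muInvariant p X₀.X = muInvariant p X.X ∧ lambdaInvariant p X.X ≤ lambdaInvariant p X₀.X :=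
  datumSelmer_nonPrimitive_moduleFinite_isTorsion_mu_eq W κ hγ L S₀
    (fun v hv _ ↦ exists_mem_decomp_apply_ne_one_of_isCyclotomic hκ (hS₀ v hv)) X hX X₀

end Cyclotomic

section Rat

/-- **The `h23`-binder-shaped form over `ℚ`** — conclusions 1–3 of
`GreenbergVatsal2000.datumSelmer_nonPrimitive_invariants` (T-GV23L's record `h23`, p285310) with
its binders, PROVED: for `E/ℚ` and the cyclotomic `ℤ_p`-extension, `X₀` is finitely generated,
`Λ`-torsion, and `μ(X₀) = μ(X)` (+ `λ(X) ≤ λ(X₀)`). The binders `_hmin` (global minimality), `_hp`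
(`p ≠ 2`), `_hC` (divisible line with `#(C ∩ A[p]) = p`) and `_hA` (`E(ℚ_∞)[p^∞]` finite) are
UNUSED — shape only (referee-1 ACK-1 proviso (iv)); consumers swapping conclusions 1–3 of `h23` for
this theorem do so by APPENDING, the `h23` form stays. Conclusions 4–5 of `h23` (`λ(X₀) = λ(X) +
Σ δ_v`, `p`-divisibility of `S^{Σ₀}/S`) are NOT claimed (GV Prop. (2.1)).
[cite: GreenbergVatsal2000, §2 Cor. (2.3) (arXiv:math/9906215 pp. 20–21)] -/
theorem datumSelmer_nonPrimitive_moduleFinite_isTorsion_mu_eq_rat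
    (W : WeierstrassCurve ℚ) [W.IsElliptic] (_hmin : W.IsGloballyMinimal) (p : ℕ) [Fact p.Prime]
    (_hp : p ≠ 2) (κ : ZpExtension ℚ p) (hκ : κ.IsCyclotomic) (γ : absoluteGaloisGroup ℚ)
    (hγ : κ.IsTopGenerator γ) (L : Data ℚ (W.geomPrimaryTorsion p) p)
    (_hC : ∀ (v : HeightOneSpectrum (𝓞 ℚ)) (hv : ((p : ℕ) : 𝓞 ℚ) ∈ v.asIdeal),
      (∀ c ∈ (L v hv).plus, ∃ c' ∈ (L v hv).plus, p • c' = c) ∧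
        Nat.card ↥((L v hv).plus ⊓ (↥(W.geomPrimaryTorsion p))[(p : ℤ)]) = p)
    (_hA : Finite (FixedPoints.addSubgroup κ.kerSubgroup (W.geomPrimaryTorsion p)))
    (S₀ : Finset (HeightOneSpectrum (𝓞 ℚ))) (hS₀ : ∀ v ∈ S₀, ((p : ℕ) : 𝓞 ℚ) ∉ v.asIdeal)
    (X : DatumDualData κ γ (W.geomPrimaryTorsion p) L (∅ : Set (HeightOneSpectrum (𝓞 ℚ))))
    [Module.Finite (IwasawaAlgebra p) X.X]
    (X₀ : DatumDualData κ γ (W.geomPrimaryTorsion p) L (↑S₀ : Set (HeightOneSpectrum (𝓞 ℚ))))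
    (hX : Module.IsTorsion (IwasawaAlgebra p) X.X) :
    Module.Finite (IwasawaAlgebra p) X₀.X ∧ Module.IsTorsion (IwasawaAlgebra p) X₀.X ∧
      muInvariant p X₀.X = muInvariant p X.X ∧ lambdaInvariant p X.X ≤ lambdaInvariant p X₀.X :=
  datumSelmer_nonPrimitive_moduleFinite_isTorsion_mu_eq_of_isCyclotomic W κ hκ hγ L S₀ hS₀ X hX X₀

end Rat

end Summit.BirchSwinnertonDyer.Rank1Residual.Iwasawa

end
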